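import Summits.CriticalPhenomena.PercolationContinuityZ3.Theorems.PercNearOneGluingNoHeavyLowerTailKnQuestion8CoefficientwiseCoreClassKernelMixBoundaryFibres
import HarnessLib

/-!
# The prefix-frozen Harris inequality (the `dark + frozen landings` cube lemma)

Support file (`--supports stmt-CriticalPhenomena-4575`, closed), prover `prim-cplus-coupling` (gen 61).  No definitions, no notations, no named facts,
no sorries; standard axioms.  Memo `prim-cplus-coupling/A5-COUPLING-gen61.md` §1.

ABSTRACT SETTING.  A finite cube `2^E` and an ordered thread `e 1, …, e ℓ ∈ E` (distinct).  For `ω ⊆ E` the RED PREFIX LENGTH is the largest `a`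
with `e 1, …, e a ∈ ω`; the class `K_a` (`0 ≤ a ≤ ℓ`) consists of the `ω` of prefix length exactly `a`.  The class-`a` PARTNER of `ω ∈ K_a` keeps
the frozen prefix `e 1, …, e (a+1)` (the whole thread if `a = ℓ`) and complements every other coordinate of `E`; for the DARK class `a = 0` the
partner is the full complement `E ∖ ω`.  In terms of the red set, the complement of the class-`a` partner is `ω ∆ {e 1, …, e (min (a+1) ℓ)}`.
* `Coefficientwise.sum_cross_le_sum_straight` — the rearrangement step `Σ f₀g₁ + f₁g₀ ≤ Σ f₀g₀ + f₁g₁` for `f₀ ≤ f₁`, `g₀ ≤ g₁`.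
* `Coefficientwise.prefix_frozen_harris` — **THE CUBE LEMMA** (functional form): for monotone `F, G : Finset ι → ℝ`,
  `Σ_{ω dark} F(ω) G(E ∖ ω) + Σ_{a=1}^{ℓ} Σ_{ω ∈ K_a} F(ω) G(ω ∆ {e 1..e (min (a+1) ℓ)}) ≤ Σ_{ω ⊆ E} F(ω) G(ω)`.
  With `F = 1_U` (`U` increasing) and `G(ω) = 1_W(E ∖ ω)` (`W` decreasing) this reads
  `#(U ∩ W ∩ K_0) + Σ_{a ≥ 1} #(U ∩ τ_a(W ∩ K_a)) ≤ #(U ∩ c(W))`: the dark sources together with ALL prefix-frozen Harris landings of the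
  red-starting classes fit into the global complement landing zone.  For `ℓ = 0` it is Harris' inequality (`sum_mul_sdiff_le_sum_mul`); the proof is
  induction on `ℓ`, peeling the LAST thread edge `e ℓ`: the middle classes split evenly over the two halves of the cube, the dark and the full class
  split crosswise, and the cross terms are dominated by the straight ones (`sum_cross_le_sum_straight`).
On a bundle (thread `z = e 1 … e ℓ` read from the hub `u`, `U = 𝒲 ∩ {X ∈ 𝐀, Y ∉ 𝐁}`, `W = {b ∈ Y ∖ X} ∩ {Y ∈ 𝐃, X ∉ 𝐂}`) this is the linear one-type
inequality `(***)` of memo gen 60 §3.8: the type-1 sources dark on `z` plus the non-honest `z`-frozen type-1 landings are at most `#L₁(𝒲)`.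
[cite: KozmaNitzan2024, Questions 8–9 (§5.5 p. 36) (context); Harris 1960]
-/

namespace Summit.CriticalPhenomena.PercolationContinuityZ3.Theorems

open Finset

namespace Coefficientwise

variable {ι : Type*}

/-- Rearrangement: for `f₀ ≤ f₁` and `g₀ ≤ g₁` pointwise on `s`, `Σ (f₀ g₁ + f₁ g₀) ≤ Σ (f₀ g₀ + f₁ g₁)`. [folklore] -/
theorem sum_cross_le_sum_straight {α : Type*} (s : Finset α) (f₀ f₁ g₀ g₁ : α → ℝ)
    (hf : ∀ x ∈ s, f₀ x ≤ f₁ x) (hg : ∀ x ∈ s, g₀ x ≤ g₁ x) :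
    ∑ x ∈ s, (f₀ x * g₁ x + f₁ x * g₀ x) ≤ ∑ x ∈ s, (f₀ x * g₀ x + f₁ x * g₁ x) := by
  refine Finset.sum_le_sum fun x hx => ?_
  have h1 := hf x hx
  have h2 := hg x hx
  nlinarith [mul_nonneg (sub_nonneg.mpr h1) (sub_nonneg.mpr h2)]

/-- `ω ∆ P` with a fresh element `d ∉ ω ∪ P` inserted on the left. [folklore] -/
theorem symmDiff_insert_left_of_notMem [DecidableEq ι] (ω P : Finset ι) (d : ι) (hω : d ∉ ω) (hP : d ∉ P) :
    symmDiff (insert d ω) P = insert d (symmDiff ω P) := by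
  ext x
  rw [symmDiff_def, symmDiff_def]
  simp only [Finset.mem_union, Finset.mem_sdiff, Finset.mem_insert, Finset.sup_eq_union]
  by_cases hx : x = d
  · subst hx; simp [hω, hP]
  · simp [hx]

/-- `ω ∆ P` with a fresh element `d ∉ ω ∪ P` inserted on the right. [folklore] -/
theorem symmDiff_insert_right_of_notMem [DecidableEq ι] (ω P : Finset ι) (d : ι) (hω : d ∉ ω) (hP : d ∉ P) :
    symmDiff ω (insert d P) = insert d (symmDiff ω P) := by
  ext x
  rw [symmDiff_def, symmDiff_def]
  simp only [Finset.mem_union, Finset.mem_sdiff, Finset.mem_insert, Finset.sup_eq_union]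
  by_cases hx : x = d
  · subst hx; simp [hω, hP]
  · simp [hx]

/-- `ω ∆ P` with a fresh element inserted on both sides. [folklore] -/
theorem symmDiff_insert_insert_of_notMem [DecidableEq ι] (ω P : Finset ι) (d : ι) (hω : d ∉ ω) (hP : d ∉ P) :
    symmDiff (insert d ω) (insert d P) = symmDiff ω P := by
  ext x
  rw [symmDiff_def, symmDiff_def]
  simp only [Finset.mem_union, Finset.mem_sdiff, Finset.mem_insert, Finset.sup_eq_union]
  by_cases hx : x = d
  · subst hx; simp [hω, hP]
  · simp [hx]

/-- `Icc 1 (n+1) = insert (n+1) (Icc 1 n)` in `ℕ`. [folklore] -/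
theorem Icc_one_succ_eq_insert (n : ℕ) : Finset.Icc 1 (n + 1) = insert (n + 1) (Finset.Icc 1 n) := by
  ext j
  simp only [Finset.mem_Icc, Finset.mem_insert]
  omega


/-- **THE CUBE LEMMA (prefix-frozen Harris inequality).**  `E` a finite ground set, `e 1, …, e ℓ ∈ E` distinct (the thread, read from the hub),
`F, G` monotone.  With `K_a = {ω : e 1..e a ∈ ω, e (a+1) ∉ ω}` (red prefix length exactly `a`; `K_ℓ = {e 1..e ℓ ∈ ω}`) and the dark class
`K_0 = {e 1 ∉ ω}`:  `Σ_{ω ∈ K_0} F(ω) G(E ∖ ω) + Σ_{a=1}^{ℓ} Σ_{ω ∈ K_a} F(ω) G(ω ∆ {e 1, …, e (min (a+1) ℓ)}) ≤ Σ_{ω ⊆ E} F(ω) G(ω)`.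
(`ℓ = 0`: Harris.)  Set form: `#(U ∩ W ∩ K_0) + Σ_{a ≥ 1} #(U ∩ τ_a(W ∩ K_a)) ≤ #(U ∩ c W)` for `U` increasing, `W` decreasing, `τ_a` = keep the
prefix `e 1..e (min (a+1) ℓ)`, complement the rest.  Proof: induction on `ℓ` peeling `e ℓ`; Harris + rearrangement.  Memo gen 61 §1.
[cite: KozmaNitzan2024, Questions 8–9 (§5.5 p. 36) (context); Harris 1960] -/
theorem prefix_frozen_harris [DecidableEq ι] (ℓ : ℕ) : ∀ (E : Finset ι) (e : ℕ → ι)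
    (_heE : ∀ j, 1 ≤ j → j ≤ ℓ → e j ∈ E)
    (_heinj : ∀ i j, 1 ≤ i → i ≤ ℓ → 1 ≤ j → j ≤ ℓ → e i = e j → i = j)
    (F G : Finset ι → ℝ) (_hF : Monotone F) (_hG : Monotone G),
    (∑ ω ∈ E.powerset with (1 ≤ ℓ → e 1 ∉ ω), F ω * G (E \ ω))
      + ∑ a ∈ Finset.Icc 1 ℓ, ∑ ω ∈ E.powerset with ((∀ j, 1 ≤ j → j ≤ a → e j ∈ ω) ∧ (a < ℓ → e (a + 1) ∉ ω)),
          F ω * G (symmDiff ω ((Finset.Icc 1 (min (a + 1) ℓ)).image e))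
    ≤ ∑ ω ∈ E.powerset, F ω * G ω := by
  induction ℓ with
  | zero =>
    intro E e _ _ F G hF hG
    have h1 : (E.powerset.filter (fun ω => 1 ≤ 0 → e 1 ∉ ω)) = E.powerset := by
      apply Finset.filter_true_of_mem; intro ω _ h; omega
    rw [h1, Finset.Icc_eq_empty_of_lt (by omega), Finset.sum_empty, add_zero]
    exact sum_mul_sdiff_le_sum_mul E F G hF hG
  | succ ℓ ih =>
    intro E e heE heinj F G hF hG
    -- the peeled edge `d = e (ℓ+1)` and the rest `E' = E.erase d`
    set d : ι := e (ℓ + 1) with hd_def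
    have hdE : d ∈ E := heE (ℓ + 1) (by omega) (le_refl _)
    set E' : Finset ι := E.erase d with hE'_def
    have hdE' : d ∉ E' := Finset.notMem_erase d E
    have hEins : E = insert d E' := (Finset.insert_erase hdE).symm
    have hej_ne : ∀ j, 1 ≤ j → j ≤ ℓ → e j ≠ d := by
      intro j hj1 hj2 h
      have := heinj j (ℓ + 1) hj1 (by omega) (by omega) (le_refl _) h
      omega
    have hejE' : ∀ j, 1 ≤ j → j ≤ ℓ → e j ∈ E' := by
      intro j hj1 hj2
      rw [hE'_def, Finset.mem_erase]; exact ⟨hej_ne j hj1 hj2, heE j hj1 (by omega)⟩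
    have heinj' : ∀ i j, 1 ≤ i → i ≤ ℓ → 1 ≤ j → j ≤ ℓ → e i = e j → i = j :=
      fun i j h1 h2 h3 h4 h => heinj i j h1 (by omega) h3 (by omega) h
    -- the two halves of F and G
    set F1 : Finset ι → ℝ := fun ω => F (insert d ω) with hF1_def
    set G1 : Finset ι → ℝ := fun ω => G (insert d ω) with hG1_def
    have hF1 : Monotone F1 := fun s t hst => hF (Finset.insert_subset_insert d hst)
    have hG1 : Monotone G1 := fun s t hst => hG (Finset.insert_subset_insert d hst)
    have hFle : ∀ ω, F ω ≤ F1 ω := fun ω => hF (Finset.subset_insert d ω)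
    have hGle : ∀ ω, G ω ≤ G1 ω := fun ω => hG (Finset.subset_insert d ω)
    -- membership facts for ω' ⊆ E'
    have hdω : ∀ ω' ∈ E'.powerset, d ∉ ω' := fun ω' hω' h => hdE' (Finset.mem_powerset.mp hω' h)
    -- the prefix sets do not contain d
    have hdpre : ∀ a, a ≤ ℓ → d ∉ (Finset.Icc 1 a).image e := by
      intro a ha h
      rw [Finset.mem_image] at h
      obtain ⟨j, hj, hje⟩ := h
      rw [Finset.mem_Icc] at hj
      exact hej_ne j hj.1 (by omega) hje
    -- RHS split
    have rhs : ∑ ω ∈ E.powerset, F ω * G ω = (∑ ω ∈ E'.powerset, F ω * G ω) + ∑ ω ∈ E'.powerset, F1 ω * G1 ω := by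
      rw [hEins, Finset.sum_powerset_insert hdE']
    -- generic expansion of a filtered sum over `E.powerset` along `d`
    have expand : ∀ (Q : Finset ι → Prop) [DecidablePred Q] (h : Finset ι → ℝ),
        (∑ ω ∈ E.powerset with Q ω, h ω) =
          ∑ ω ∈ E'.powerset, ((if Q ω then h ω else 0) + (if Q (insert d ω) then h (insert d ω) else 0)) := by
      intro Q _ h
      rw [Finset.sum_filter, hEins, Finset.sum_powerset_insert hdE', ← Finset.sum_add_distrib]
    -- set-difference bookkeeping
    have sdiff0 : ∀ ω' ∈ E'.powerset, E \ ω' = insert d (E' \ ω') := by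
      intro ω' hω'
      rw [hEins, Finset.insert_sdiff_of_notMem E' (hdω ω' hω')]
    have sdiff1 : ∀ ω' ∈ E'.powerset, E \ insert d ω' = E' \ ω' := by
      intro ω' hω'
      rw [hEins]
      ext x
      simp only [Finset.mem_sdiff, Finset.mem_insert, not_or]
      constructor
      · rintro ⟨h1, h2, h3⟩
        rcases h1 with h1 | h1
        · exact absurd h1 h2
        · exact ⟨h1, h3⟩
      · rintro ⟨h1, h3⟩
        exact ⟨Or.inr h1, fun h => hdE' (h ▸ h1), h3⟩
    -- the class-`a` terms, `1 ≤ a ≤ ℓ`: even split for `a < ℓ`, cross split for `a = ℓ` (together with the term `a = ℓ + 1`)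
    have key : ∀ a, 1 ≤ a → a ≤ ℓ →
        (∑ ω ∈ E.powerset with ((∀ j, 1 ≤ j → j ≤ a → e j ∈ ω) ∧ (a < ℓ + 1 → e (a + 1) ∉ ω)),
            F ω * G (symmDiff ω ((Finset.Icc 1 (min (a + 1) (ℓ + 1))).image e)))
          + (if a = ℓ then
              ∑ ω ∈ E.powerset with ((∀ j, 1 ≤ j → j ≤ ℓ + 1 → e j ∈ ω) ∧ (ℓ + 1 < ℓ + 1 → e (ℓ + 1 + 1) ∉ ω)),
                F ω * G (symmDiff ω ((Finset.Icc 1 (min (ℓ + 1 + 1) (ℓ + 1))).image e))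
             else 0)
        ≤ (∑ ω ∈ E'.powerset with ((∀ j, 1 ≤ j → j ≤ a → e j ∈ ω) ∧ (a < ℓ → e (a + 1) ∉ ω)),
              F ω * G (symmDiff ω ((Finset.Icc 1 (min (a + 1) ℓ)).image e)))
          + ∑ ω ∈ E'.powerset with ((∀ j, 1 ≤ j → j ≤ a → e j ∈ ω) ∧ (a < ℓ → e (a + 1) ∉ ω)),
              F1 ω * G1 (symmDiff ω ((Finset.Icc 1 (min (a + 1) ℓ)).image e)) := by
      intro a ha1 haℓ
      by_cases hlt : a < ℓ
      · -- even split
        have hne : a ≠ ℓ := by omega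
        rw [if_neg hne, add_zero]
        have hmin1 : min (a + 1) (ℓ + 1) = a + 1 := by omega
        have hmin2 : min (a + 1) ℓ = a + 1 := by omega
        rw [hmin1, hmin2]
        set P : Finset ι := (Finset.Icc 1 (a + 1)).image e with hP_def
        have hdP : d ∉ P := hdpre (a + 1) (by omega)
        rw [expand, Finset.sum_filter, Finset.sum_filter, ← Finset.sum_add_distrib]
        refine le_of_eq (Finset.sum_congr rfl fun ω' hω' => ?_)
        have hdω' : d ∉ ω' := hdω ω' hω'
        have hQ0 : ((∀ j, 1 ≤ j → j ≤ a → e j ∈ ω') ∧ (a < ℓ + 1 → e (a + 1) ∉ ω')) ↔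
            ((∀ j, 1 ≤ j → j ≤ a → e j ∈ ω') ∧ (a < ℓ → e (a + 1) ∉ ω')) := by
          constructor
          · rintro ⟨h1, h2⟩; exact ⟨h1, fun _ => h2 (by omega)⟩
          · rintro ⟨h1, h2⟩; exact ⟨h1, fun _ => h2 hlt⟩
        have hQ1 : ((∀ j, 1 ≤ j → j ≤ a → e j ∈ insert d ω') ∧ (a < ℓ + 1 → e (a + 1) ∉ insert d ω')) ↔
            ((∀ j, 1 ≤ j → j ≤ a → e j ∈ ω') ∧ (a < ℓ → e (a + 1) ∉ ω')) := by
          constructor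
          · rintro ⟨h1, h2⟩
            refine ⟨fun j hj1 hj2 => ?_, fun _ => fun h => h2 (by omega) (Finset.mem_insert_of_mem h)⟩
            have := h1 j hj1 hj2
            rw [Finset.mem_insert] at this
            rcases this with h | h
            · exact absurd h (hej_ne j hj1 (by omega))
            · exact h
          · rintro ⟨h1, h2⟩
            refine ⟨fun j hj1 hj2 => Finset.mem_insert_of_mem (h1 j hj1 hj2), fun _ => fun h => ?_⟩
            rw [Finset.mem_insert] at h
            rcases h with h | h
            · exact hej_ne (a + 1) (by omega) (by omega) h
            · exact h2 hlt h
        have hsd : symmDiff (insert d ω') P = insert d (symmDiff ω' P) := symmDiff_insert_left_of_notMem ω' P d hdω' hdP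
        rw [hsd]
        by_cases hq : (∀ j, 1 ≤ j → j ≤ a → e j ∈ ω') ∧ (a < ℓ → e (a + 1) ∉ ω')
        · rw [if_pos (hQ0.mpr hq), if_pos (hQ1.mpr hq), if_pos hq, if_pos hq]
        · rw [if_neg (fun h => hq (hQ0.mp h)), if_neg (fun h => hq (hQ1.mp h)), if_neg hq, if_neg hq]
      · -- a = ℓ : cross split
        have haeq : a = ℓ := by omega
        subst haeq
        rw [if_pos rfl]
        have hmin1 : min (a + 1) (a + 1) = a + 1 := by omega
        have hmin2 : min (a + 1) a = a := by omega
        have hmin3 : min (a + 1 + 1) (a + 1) = a + 1 := by omega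
        rw [hmin1, hmin2, hmin3]
        set P : Finset ι := (Finset.Icc 1 a).image e with hP_def
        have hdP : d ∉ P := hdpre a (le_refl a)
        have hPsucc : (Finset.Icc 1 (a + 1)).image e = insert d P := by
          rw [Icc_one_succ_eq_insert, Finset.image_insert]
        rw [hPsucc]
        rw [expand, expand
          (fun ω => (∀ j, 1 ≤ j → j ≤ a + 1 → e j ∈ ω) ∧ (a + 1 < a + 1 → e (a + 1 + 1) ∉ ω))]
        rw [Finset.sum_filter, Finset.sum_filter, ← Finset.sum_add_distrib, ← Finset.sum_add_distrib]
        -- pointwise: the two cross terms at ω' are F ω' G1(..) and F1 ω' G(..); bound by the straight terms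
        have hpt : ∀ ω' ∈ E'.powerset,
            ((if (∀ j, 1 ≤ j → j ≤ a → e j ∈ ω') ∧ (a < a + 1 → e (a + 1) ∉ ω') then
                F ω' * G (symmDiff ω' (insert d P)) else 0)
              + (if (∀ j, 1 ≤ j → j ≤ a → e j ∈ insert d ω') ∧ (a < a + 1 → e (a + 1) ∉ insert d ω') then
                F (insert d ω') * G (symmDiff (insert d ω') (insert d P)) else 0))
            + ((if (∀ j, 1 ≤ j → j ≤ a + 1 → e j ∈ ω') ∧ (a + 1 < a + 1 → e (a + 1 + 1) ∉ ω') then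
                F ω' * G (symmDiff ω' (insert d P)) else 0)
              + (if (∀ j, 1 ≤ j → j ≤ a + 1 → e j ∈ insert d ω') ∧ (a + 1 < a + 1 → e (a + 1 + 1) ∉ insert d ω') then
                F (insert d ω') * G (symmDiff (insert d ω') (insert d P)) else 0))
            = (if (∀ j, 1 ≤ j → j ≤ a → e j ∈ ω') ∧ (a < a → e (a + 1) ∉ ω') then
                (F ω' * G1 (symmDiff ω' P) + F1 ω' * G (symmDiff ω' P)) else 0) := by
          intro ω' hω'
          have hdω' : d ∉ ω' := hdω ω' hω'
          have hsdR : symmDiff ω' (insert d P) = insert d (symmDiff ω' P) := symmDiff_insert_right_of_notMem ω' P d hdω' hdP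
          have hsdB : symmDiff (insert d ω') (insert d P) = symmDiff ω' P := symmDiff_insert_insert_of_notMem ω' P d hdω' hdP
          rw [hsdR, hsdB]
          -- second summand of the first pair vanishes (d = e (a+1) ∈ insert d ω'), first summand of the second pair vanishes (d ∉ ω')
          have hv1 : ¬ ((∀ j, 1 ≤ j → j ≤ a → e j ∈ insert d ω') ∧ (a < a + 1 → e (a + 1) ∉ insert d ω')) := by
            rintro ⟨_, h2⟩; exact h2 (by omega) (Finset.mem_insert_self d ω')
          have hv2 : ¬ ((∀ j, 1 ≤ j → j ≤ a + 1 → e j ∈ ω') ∧ (a + 1 < a + 1 → e (a + 1 + 1) ∉ ω')) := by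
            rintro ⟨h1, _⟩; exact hdω' (h1 (a + 1) (by omega) (le_refl _))
          rw [if_neg hv1, if_neg hv2, add_zero, zero_add]
          by_cases hq : (∀ j, 1 ≤ j → j ≤ a → e j ∈ ω') ∧ (a < a → e (a + 1) ∉ ω')
          · have hq1 : (∀ j, 1 ≤ j → j ≤ a → e j ∈ ω') ∧ (a < a + 1 → e (a + 1) ∉ ω') := ⟨hq.1, fun _ => hdω'⟩
            have hq2 : (∀ j, 1 ≤ j → j ≤ a + 1 → e j ∈ insert d ω') ∧ (a + 1 < a + 1 → e (a + 1 + 1) ∉ insert d ω') := by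
              refine ⟨fun j hj1 hj2 => ?_, fun h => absurd h (lt_irrefl _)⟩
              by_cases hj : j = a + 1
              · subst hj; exact Finset.mem_insert_self d ω'
              · exact Finset.mem_insert_of_mem (hq.1 j hj1 (by omega))
            rw [if_pos hq1, if_pos hq2, if_pos hq]
          · have hq1 : ¬ ((∀ j, 1 ≤ j → j ≤ a → e j ∈ ω') ∧ (a < a + 1 → e (a + 1) ∉ ω')) := by
              rintro ⟨h1, _⟩; exact hq ⟨h1, fun h => absurd h (lt_irrefl _)⟩
            have hq2 : ¬ ((∀ j, 1 ≤ j → j ≤ a + 1 → e j ∈ insert d ω') ∧ (a + 1 < a + 1 → e (a + 1 + 1) ∉ insert d ω')) := by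
              rintro ⟨h1, _⟩
              refine hq ⟨fun j hj1 hj2 => ?_, fun h => absurd h (lt_irrefl _)⟩
              have := h1 j hj1 (by omega)
              rw [Finset.mem_insert] at this
              rcases this with h | h
              · exact absurd h (hej_ne j hj1 hj2)
              · exact h
            rw [if_neg hq1, if_neg hq2, if_neg hq, add_zero]
        rw [Finset.sum_congr rfl hpt, ← Finset.sum_filter]
        have hr : (∑ x ∈ E'.powerset,
              ((if (∀ j, 1 ≤ j → j ≤ a → e j ∈ x) ∧ (a < a → e (a + 1) ∉ x) then F x * G (symmDiff x P) else 0)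
               + (if (∀ j, 1 ≤ j → j ≤ a → e j ∈ x) ∧ (a < a → e (a + 1) ∉ x) then F1 x * G1 (symmDiff x P) else 0)))
            = ∑ x ∈ E'.powerset with ((∀ j, 1 ≤ j → j ≤ a → e j ∈ x) ∧ (a < a → e (a + 1) ∉ x)),
                (F x * G (symmDiff x P) + F1 x * G1 (symmDiff x P)) := by
          rw [Finset.sum_filter]
          refine Finset.sum_congr rfl fun x _ => ?_
          split_ifs <;> simp
        rw [hr]
        -- rearrangement
        exact sum_cross_le_sum_straight
          (E'.powerset.filter (fun ω' => (∀ j, 1 ≤ j → j ≤ a → e j ∈ ω') ∧ (a < a → e (a + 1) ∉ ω')))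
          F F1 (fun ω' => G (symmDiff ω' P)) (fun ω' => G1 (symmDiff ω' P))
          (fun ω' _ => hFle ω') (fun ω' _ => hGle _)
    -- the IH on E' for both halves
    have ih0 := ih E' e hejE' heinj' F G hF hG
    have ih1 := ih E' e hejE' heinj' F1 G1 hF1 hG1
    -- split off the last class `a = ℓ + 1`
    rw [Finset.sum_Icc_succ_top (by omega)]
    by_cases hℓ : ℓ = 0
    · -- base-like step ℓ = 0: dark term = Σ F ω' G1(E' \ ω'), class 1 = Σ F1 ω' G ω'
      subst hℓ
      have hd1 : e 1 = d := by rw [hd_def]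
      rw [Finset.Icc_eq_empty_of_lt (by omega), Finset.sum_empty, zero_add]
      have hdark : (∑ ω ∈ E.powerset with (1 ≤ 0 + 1 → e 1 ∉ ω), F ω * G (E \ ω))
          = ∑ ω' ∈ E'.powerset, F ω' * G1 (E' \ ω') := by
        rw [expand]
        refine Finset.sum_congr rfl fun ω' hω' => ?_
        have hdω' : d ∉ ω' := hdω ω' hω'
        have h1 : (1 ≤ 0 + 1 → e 1 ∉ ω') := fun _ => by rw [hd1]; exact hdω'
        have h2 : ¬ (1 ≤ 0 + 1 → e 1 ∉ insert d ω') := fun h => h (by omega) (by rw [hd1]; exact Finset.mem_insert_self d ω')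
        rw [if_pos h1, if_neg h2, add_zero, sdiff0 ω' hω']
      have hone : (∑ ω ∈ E.powerset with ((∀ j, 1 ≤ j → j ≤ 0 + 1 → e j ∈ ω) ∧ (0 + 1 < 0 + 1 → e (0 + 1 + 1) ∉ ω)),
            F ω * G (symmDiff ω ((Finset.Icc 1 (min (0 + 1 + 1) (0 + 1))).image e)))
          = ∑ ω' ∈ E'.powerset, F1 ω' * G ω' := by
        rw [expand]
        have hP : (Finset.Icc 1 (min (0 + 1 + 1) (0 + 1))).image e = {d} := by
          have : min (0 + 1 + 1) (0 + 1) = 1 := by omega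
          rw [this, Finset.Icc_self, Finset.image_singleton, hd1]
        rw [hP]
        refine Finset.sum_congr rfl fun ω' hω' => ?_
        have hdω' : d ∉ ω' := hdω ω' hω'
        have h1 : ¬ ((∀ j, 1 ≤ j → j ≤ 0 + 1 → e j ∈ ω') ∧ (0 + 1 < 0 + 1 → e (0 + 1 + 1) ∉ ω')) := by
          rintro ⟨h, _⟩; exact hdω' (by rw [← hd1]; exact h 1 (le_refl 1) (by omega))
        have h2 : ((∀ j, 1 ≤ j → j ≤ 0 + 1 → e j ∈ insert d ω') ∧ (0 + 1 < 0 + 1 → e (0 + 1 + 1) ∉ insert d ω')) := by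
          refine ⟨fun j hj1 hj2 => ?_, fun h => absurd h (lt_irrefl _)⟩
          have : j = 1 := by omega
          subst this; rw [hd1]; exact Finset.mem_insert_self d ω'
        have hsd : symmDiff (insert d ω') ({d} : Finset ι) = ω' := by
          have := symmDiff_insert_insert_of_notMem ω' (∅ : Finset ι) d hdω' (Finset.notMem_empty d)
          rw [Finset.insert_empty] at this
          rw [this, symmDiff_def]; simp
        rw [if_neg h1, if_pos h2, zero_add, hsd]
      rw [hdark, hone, rhs]
      have harris := sum_mul_sdiff_le_sum_mul E' F G1 hF hG1
      have rearr := sum_cross_le_sum_straight E'.powerset F F1 G G1 (fun ω' _ => hFle ω') (fun ω' _ => hGle ω')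
      rw [Finset.sum_add_distrib] at rearr
      rw [Finset.sum_add_distrib] at rearr
      linarith
    · -- ℓ ≥ 1
      have hℓ1 : 1 ≤ ℓ := Nat.one_le_iff_ne_zero.mpr hℓ
      have he1 : e 1 ≠ d := hej_ne 1 (le_refl 1) hℓ1
      -- dark term: cross split, then rearrangement
      have hdark : (∑ ω ∈ E.powerset with (1 ≤ ℓ + 1 → e 1 ∉ ω), F ω * G (E \ ω))
          ≤ (∑ ω' ∈ E'.powerset with (1 ≤ ℓ → e 1 ∉ ω'), F ω' * G (E' \ ω'))
            + ∑ ω' ∈ E'.powerset with (1 ≤ ℓ → e 1 ∉ ω'), F1 ω' * G1 (E' \ ω') := by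
        rw [expand]
        have hpt : ∀ ω' ∈ E'.powerset,
            ((if (1 ≤ ℓ + 1 → e 1 ∉ ω') then F ω' * G (E \ ω') else 0)
              + (if (1 ≤ ℓ + 1 → e 1 ∉ insert d ω') then F (insert d ω') * G (E \ insert d ω') else 0))
            = (if (1 ≤ ℓ → e 1 ∉ ω') then (F ω' * G1 (E' \ ω') + F1 ω' * G (E' \ ω')) else 0) := by
          intro ω' hω'
          rw [sdiff0 ω' hω', sdiff1 ω' hω']
          by_cases hq : e 1 ∈ ω'
          · have h1 : ¬ (1 ≤ ℓ + 1 → e 1 ∉ ω') := fun h => h (by omega) hq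
            have h2 : ¬ (1 ≤ ℓ + 1 → e 1 ∉ insert d ω') := fun h => h (by omega) (Finset.mem_insert_of_mem hq)
            have h3 : ¬ (1 ≤ ℓ → e 1 ∉ ω') := fun h => h hℓ1 hq
            rw [if_neg h1, if_neg h2, if_neg h3, add_zero]
          · have h1 : (1 ≤ ℓ + 1 → e 1 ∉ ω') := fun _ => hq
            have h2 : (1 ≤ ℓ + 1 → e 1 ∉ insert d ω') := fun _ h => by
              rw [Finset.mem_insert] at h
              rcases h with h | h
              · exact he1 h
              · exact hq h
            have h3 : (1 ≤ ℓ → e 1 ∉ ω') := fun _ => hq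
            rw [if_pos h1, if_pos h2, if_pos h3]
        rw [Finset.sum_congr rfl hpt, ← Finset.sum_filter, ← Finset.sum_add_distrib]
        exact sum_cross_le_sum_straight _ F F1 (fun ω' => G (E' \ ω')) (fun ω' => G1 (E' \ ω'))
          (fun ω' _ => hFle ω') (fun ω' _ => hGle _)
      -- middle and top classes via `key`
      have hmid : (∑ a ∈ Finset.Icc 1 ℓ, ∑ ω ∈ E.powerset with ((∀ j, 1 ≤ j → j ≤ a → e j ∈ ω) ∧ (a < ℓ + 1 → e (a + 1) ∉ ω)),
              F ω * G (symmDiff ω ((Finset.Icc 1 (min (a + 1) (ℓ + 1))).image e)))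
            + ∑ ω ∈ E.powerset with ((∀ j, 1 ≤ j → j ≤ ℓ + 1 → e j ∈ ω) ∧ (ℓ + 1 < ℓ + 1 → e (ℓ + 1 + 1) ∉ ω)),
                F ω * G (symmDiff ω ((Finset.Icc 1 (min (ℓ + 1 + 1) (ℓ + 1))).image e))
          ≤ (∑ a ∈ Finset.Icc 1 ℓ, ∑ ω ∈ E'.powerset with ((∀ j, 1 ≤ j → j ≤ a → e j ∈ ω) ∧ (a < ℓ → e (a + 1) ∉ ω)),
              F ω * G (symmDiff ω ((Finset.Icc 1 (min (a + 1) ℓ)).image e)))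
            + ∑ a ∈ Finset.Icc 1 ℓ, ∑ ω ∈ E'.powerset with ((∀ j, 1 ≤ j → j ≤ a → e j ∈ ω) ∧ (a < ℓ → e (a + 1) ∉ ω)),
              F1 ω * G1 (symmDiff ω ((Finset.Icc 1 (min (a + 1) ℓ)).image e)) := by
        have hℓmem : ℓ ∈ Finset.Icc 1 ℓ := Finset.mem_Icc.mpr ⟨hℓ1, le_refl ℓ⟩
        have htop : (∑ ω ∈ E.powerset with ((∀ j, 1 ≤ j → j ≤ ℓ + 1 → e j ∈ ω) ∧ (ℓ + 1 < ℓ + 1 → e (ℓ + 1 + 1) ∉ ω)),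
                F ω * G (symmDiff ω ((Finset.Icc 1 (min (ℓ + 1 + 1) (ℓ + 1))).image e)))
            = ∑ a ∈ Finset.Icc 1 ℓ, (if a = ℓ then
                ∑ ω ∈ E.powerset with ((∀ j, 1 ≤ j → j ≤ ℓ + 1 → e j ∈ ω) ∧ (ℓ + 1 < ℓ + 1 → e (ℓ + 1 + 1) ∉ ω)),
                  F ω * G (symmDiff ω ((Finset.Icc 1 (min (ℓ + 1 + 1) (ℓ + 1))).image e)) else 0) := by
          rw [Finset.sum_ite_eq' (Finset.Icc 1 ℓ) ℓ, if_pos hℓmem]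
        rw [htop, ← Finset.sum_add_distrib, ← Finset.sum_add_distrib]
        refine Finset.sum_le_sum fun a ha => ?_
        rw [Finset.mem_Icc] at ha
        exact key a ha.1 ha.2
      rw [rhs]
      linarith [hdark, hmid, ih0, ih1]

end Coefficientwise

end Summit.CriticalPhenomena.PercolationContinuityZ3.Theorems
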